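import Mathlib
import Summits.ValiantsHypothesis.ValiantsHypothesis.Theorems.NewtonUnitEquationsTwoProductsRankOneFourLawPlanar
import Summits.ValiantsHypothesis.ValiantsHypothesis.Theorems.TwoProducts.Negative.ClassCoverSharedAlphabet
import Summits.ValiantsHypothesis.ValiantsHypothesis.Theorems.TwoProducts.Negative.TwoSidedShapeEscapes
import Summits.ValiantsHypothesis.ValiantsHypothesis.Theorems.TwoProducts.Negative.UnitTwoThreeEscapes
import HarnessLib

/-!
# `TwoProducts` (stmt-ValiantsHypothesis-5906), line `relation_ladder` — NEGATIVE lane: RIGIDITY of the rank-one datum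
# (a relation with a coefficient `1` admits exactly ONE rung shape: its own)

Helper file of the Negative lane (val-neg-1 g4; `--supports stmt-ValiantsHypothesis-5906`; closes NO item).  The escape lemmas of
`…Negative.TwoSidedShapeEscapes` (shape `α + 2β = γ + δ`) and `…Negative.UnitTwoThreeEscapes` (shape `α + β = γ + δ + ε`) say which data
FAIL on the first inhabitants of `ResidualLawV20` after R8.  This file proves the sharp form: which data can SUCCEED at all.

* `k_eq_one_of_shift`, `shift_rigid` (datum level) — if a coincidence `P ~ Q` has a letter of excess exactly `1` (`P e₀ = Q e₀ + 1`), then any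
  `k`-shift `P + k•ρ⁺ = Q + k•ρ⁻` (or swapped) has `k = 1`, hence `ρ⁻ − ρ⁺ = ±(P − Q)` POINTWISE: the datum's difference IS the relation
  vector, up to orientation; only a common part `min(ρ⁺, ρ⁻)` is free.
* `datum_rigid` (shape `α + 2β = γ + δ`) and `datum_rigid_iv` (shape `α + β = γ + δ + ε`): every datum `(ρ⁺, ρ⁻)` with
  `RankOneCoincidences A ρ⁺ ρ⁻` satisfies `P + ρ⁺ = Q + ρ⁻` or `Q + ρ⁺ = P + ρ⁻` pointwise; with disjoint supports (as in every typed rung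
  R6 … R8) the datum is literally `(e_γ + e_δ, e_α + 2e_β)` resp. `(e_γ + e_δ + e_ε, e_α + e_β)` or its swap (`datum_values`,
  `datum_values_iv`: all values on the letters and vanishing off them).

READING (information for the line owner, not an objection): for one-relation families whose relation has a coefficient `1`, «rung with datum
shape `D` removes family with relation shape `R`» forces `D = R` up to orientation — one rung per relation shape, and there are infinitely
many shapes at the HYP1 threshold `t₀(m)` (memo #44 §1); together with ✓ `…Negative.RankTwoEscapes` (rank ≥ 2 fits NO datum) this is the
kernel content of «the residual asks for a rung SCHEMA over `(ρ⁺, ρ⁻)` plus a rank-two law».  Honest framing: `TwoProducts` (5906), the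
residual LAW and VP ≠ VNP are NOT proved here and are not claimed. [folklore]
-/

namespace Summit.ValiantsHypothesis.Theorems.TwoProducts.Negative.RankOneRigidity

open Finset
open Summit.ValiantsHypothesis.ValiantsHypothesis.Theorems.NewtonUnitEquations.TwoProducts.FormalLogLinearisation (Expo)
open Summit.ValiantsHypothesis.ValiantsHypothesis.Theorems.NewtonUnitEquations.TwoProducts.PlanarCell (tuples)
open Summit.ValiantsHypothesis.ValiantsHypothesis.Theorems.NewtonUnitEquations.TwoProducts.PermutationType
  (msetT RankOneCoincidences)
open Summit.ValiantsHypothesis.Theorems.TwoProducts.Negative.ClassCoverBound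
open Summit.ValiantsHypothesis.Theorems.TwoProducts.Negative.TwoSidedEscape
open Summit.ValiantsHypothesis.Theorems.TwoProducts.Negative.UnitTwoThreeEscape

variable {m : ℕ}

/-! ### Datum level: an excess of modulus one forces `k = 1` -/

/-- `1 + k·a = k·b` forces `k = 1`. [folklore] -/
theorem k_eq_one_of_shift {a b k : ℕ} (h : 1 + k * a = k * b) : k = 1 := by
  have hk0 : k ≠ 0 := by
    rintro rfl
    simp at h
  have hab : a < b := Nat.lt_of_mul_lt_mul_left (a := k) (by omega)
  obtain ⟨c, rfl⟩ := Nat.exists_eq_add_of_lt hab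
  have : k * (a + c + 1) = k * a + k * c + k := by ring
  omega

/-- **Rigidity of the shift.**  If `P e₀ = Q e₀ + 1` at some letter, a `k`-shift between `P, Q` and a datum `(ρp, ρm)` (either orientation)
has `k = 1`: the datum satisfies `P + ρp = Q + ρm` or `Q + ρp = P + ρm` pointwise. [folklore] -/
theorem shift_rigid {P Q ρp ρm : Expo →₀ ℕ} {e₀ : Expo} (he₀ : P e₀ = Q e₀ + 1) (k : ℕ)
    (hk : P + k • ρp = Q + k • ρm ∨ Q + k • ρp = P + k • ρm) :
    (∀ e, P e + ρp e = Q e + ρm e) ∨ (∀ e, Q e + ρp e = P e + ρm e) := by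
  have ev : ∀ {X Y : Expo →₀ ℕ}, X + k • ρp = Y + k • ρm → ∀ e, X e + k * ρp e = Y e + k * ρm e := fun h e => by
    have := DFunLike.congr_fun h e
    simpa only [Finsupp.add_apply, Finsupp.smul_apply, smul_eq_mul] using this
  rcases hk with h | h
  · have h0 := ev h e₀
    rw [he₀] at h0
    have hk1 : k = 1 := k_eq_one_of_shift (a := ρp e₀) (b := ρm e₀) (by omega)
    subst hk1
    exact Or.inl fun e => by simpa using ev h e
  · have h0 := ev h e₀
    rw [he₀] at h0
    have hk1 : k = 1 := k_eq_one_of_shift (a := ρm e₀) (b := ρp e₀) (by omega)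
    subst hk1
    exact Or.inr fun e => by simpa using ev h e

/-- Pointwise consequence under disjoint supports: `x + a = y + b`, `a = 0 ∨ b = 0` determine `a, b`. [folklore] -/
theorem values_of_disjoint {x y a b : ℕ} (h : x + a = y + b) (hd : a = 0 ∨ b = 0) : a = y - x ∧ b = x - y := by omega

/-! ### Shape `α + 2β = γ + δ` -/

section TwoSided

variable {E : Finset Expo} {A : Fin m → Finset Expo} (hA : ∀ l, A l = E) {α β γ δ : Expo}
  (hα : α ∈ E) (hβ : β ∈ E) (hγ : γ ∈ E) (hδ : δ ∈ E) (hα0 : α ≠ 0) (hβ0 : β ≠ 0) (hγ0 : γ ≠ 0) (hδ0 : δ ≠ 0)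
  (hαβ : α ≠ β) (hαγ : α ≠ γ) (hαδ : α ≠ δ) (hβγ : β ≠ γ) (hβδ : β ≠ δ) (hγδ : γ ≠ δ)
  (hrel : α + 2 • β = γ + δ) {i j k : Fin m} (hij : i ≠ j) (hik : i ≠ k) (hjk : j ≠ k)
include hA hα hβ hγ hδ hα0 hβ0 hγ0 hδ0 hαβ hαγ hαδ hrel hij hik hjk

/-- **Rigidity, shape `α + 2β = γ + δ`**: a rank-one datum differs from `(e_γ + e_δ, e_α + 2e_β)` — or from its swap — only by a common
part: `P + ρ⁺ = Q + ρ⁻` or `Q + ρ⁺ = P + ρ⁻` pointwise (`P = e_α + e_β + e_β`, `Q = e_γ + e_δ`). [folklore] -/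
theorem datum_rigid {ρp ρm : Expo →₀ ℕ} (h : RankOneCoincidences A ρp ρm) :
    (∀ e, (Finsupp.single α 1 + Finsupp.single β 1 + Finsupp.single β 1 : Expo →₀ ℕ) e + ρp e =
        (Finsupp.single γ 1 + Finsupp.single δ 1 : Expo →₀ ℕ) e + ρm e) ∨
      (∀ e, (Finsupp.single γ 1 + Finsupp.single δ 1 : Expo →₀ ℕ) e + ρp e =
        (Finsupp.single α 1 + Finsupp.single β 1 + Finsupp.single β 1 : Expo →₀ ℕ) e + ρm e) := by
  obtain ⟨k, hk⟩ := shift_of_rankOne hA hα hβ hγ hδ hα0 hβ0 hγ0 hδ0 hrel hij hik hjk h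
  exact shift_rigid (e₀ := α) (by simp [hαβ, hαγ, hαδ]) k hk

include hβγ hβδ hγδ in
/-- **The only disjoint-support datum is the relation shape itself** (shape `α + 2β = γ + δ`): values `ρ⁺ = e_γ + e_δ`, `ρ⁻ = e_α + 2e_β`
on the letters and `0` off them — or the swap. [folklore] -/
theorem datum_values {ρp ρm : Expo →₀ ℕ} (hdis : ∀ e, ρp e = 0 ∨ ρm e = 0) (h : RankOneCoincidences A ρp ρm) :
    (ρp α = 0 ∧ ρp β = 0 ∧ ρp γ = 1 ∧ ρp δ = 1 ∧ ρm α = 1 ∧ ρm β = 2 ∧ ρm γ = 0 ∧ ρm δ = 0 ∧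
        ∀ e, e ≠ α → e ≠ β → e ≠ γ → e ≠ δ → ρp e = 0 ∧ ρm e = 0) ∨
      (ρm α = 0 ∧ ρm β = 0 ∧ ρm γ = 1 ∧ ρm δ = 1 ∧ ρp α = 1 ∧ ρp β = 2 ∧ ρp γ = 0 ∧ ρp δ = 0 ∧
        ∀ e, e ≠ α → e ≠ β → e ≠ γ → e ≠ δ → ρp e = 0 ∧ ρm e = 0) := by
  have Pα : (Finsupp.single α 1 + Finsupp.single β 1 + Finsupp.single β 1 : Expo →₀ ℕ) α = 1 := by simp [hαβ]
  have Pβ : (Finsupp.single α 1 + Finsupp.single β 1 + Finsupp.single β 1 : Expo →₀ ℕ) β = 2 := by simp [Ne.symm hαβ]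
  have Pγ : (Finsupp.single α 1 + Finsupp.single β 1 + Finsupp.single β 1 : Expo →₀ ℕ) γ = 0 := by
    simp [Ne.symm hαγ, Ne.symm hβγ]
  have Pδ : (Finsupp.single α 1 + Finsupp.single β 1 + Finsupp.single β 1 : Expo →₀ ℕ) δ = 0 := by
    simp [Ne.symm hαδ, Ne.symm hβδ]
  have Qα : (Finsupp.single γ 1 + Finsupp.single δ 1 : Expo →₀ ℕ) α = 0 := by simp [hαγ, hαδ]
  have Qβ : (Finsupp.single γ 1 + Finsupp.single δ 1 : Expo →₀ ℕ) β = 0 := by simp [hβγ, hβδ]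
  have Qγ : (Finsupp.single γ 1 + Finsupp.single δ 1 : Expo →₀ ℕ) γ = 1 := by simp [hγδ]
  have Qδ : (Finsupp.single γ 1 + Finsupp.single δ 1 : Expo →₀ ℕ) δ = 1 := by simp [Ne.symm hγδ]
  have Pe : ∀ e, e ≠ α → e ≠ β → (Finsupp.single α 1 + Finsupp.single β 1 + Finsupp.single β 1 : Expo →₀ ℕ) e = 0 :=
    fun e ha hb => by simp [Ne.symm ha, Ne.symm hb]
  have Qe : ∀ e, e ≠ γ → e ≠ δ → (Finsupp.single γ 1 + Finsupp.single δ 1 : Expo →₀ ℕ) e = 0 :=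
    fun e hc hd => by simp [Ne.symm hc, Ne.symm hd]
  rcases datum_rigid hA hα hβ hγ hδ hα0 hβ0 hγ0 hδ0 hαβ hαγ hαδ hrel hij hik hjk h with H | H
  · left
    have a := values_of_disjoint (H α) (hdis α); have b := values_of_disjoint (H β) (hdis β)
    have c := values_of_disjoint (H γ) (hdis γ); have d := values_of_disjoint (H δ) (hdis δ)
    rw [Pα, Qα] at a; rw [Pβ, Qβ] at b; rw [Pγ, Qγ] at c; rw [Pδ, Qδ] at d
    refine ⟨a.1, b.1, c.1, d.1, a.2, b.2, c.2, d.2, fun e ha hb hc hd => ?_⟩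
    have x := values_of_disjoint (H e) (hdis e)
    rw [Pe e ha hb, Qe e hc hd] at x
    exact x
  · right
    have a := values_of_disjoint (H α) (hdis α); have b := values_of_disjoint (H β) (hdis β)
    have c := values_of_disjoint (H γ) (hdis γ); have d := values_of_disjoint (H δ) (hdis δ)
    rw [Pα, Qα] at a; rw [Pβ, Qβ] at b; rw [Pγ, Qγ] at c; rw [Pδ, Qδ] at d
    refine ⟨a.2, b.2, c.2, d.2, a.1, b.1, c.1, d.1, fun e ha hb hc hd => ?_⟩
    have x := values_of_disjoint (H e) (hdis e)
    rw [Pe e ha hb, Qe e hc hd] at x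
    exact ⟨x.1, x.2⟩

end TwoSided

/-! ### Shape `α + β = γ + δ + ε` -/

section UnitTwoThree

variable {E : Finset Expo} {A : Fin m → Finset Expo} (hA : ∀ l, A l = E) {α β γ δ ε : Expo}
  (hα : α ∈ E) (hβ : β ∈ E) (hγ : γ ∈ E) (hδ : δ ∈ E) (hε : ε ∈ E)
  (hα0 : α ≠ 0) (hβ0 : β ≠ 0) (hγ0 : γ ≠ 0) (hδ0 : δ ≠ 0) (hε0 : ε ≠ 0)
  (hαβ : α ≠ β) (hαγ : α ≠ γ) (hαδ : α ≠ δ) (hαε : α ≠ ε)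
  (hrel : α + β = γ + δ + ε) {i j k : Fin m} (hij : i ≠ j) (hik : i ≠ k) (hjk : j ≠ k)
include hA hα hβ hγ hδ hε hα0 hβ0 hγ0 hδ0 hε0 hαβ hαγ hαδ hαε hrel hij hik hjk

/-- **Rigidity, shape `α + β = γ + δ + ε`**: a rank-one datum differs from `(e_γ + e_δ + e_ε, e_α + e_β)` — or from its swap — only by a
common part (`P = e_α + e_β`, `Q = e_γ + e_δ + e_ε`). [folklore] -/
theorem datum_rigid_iv {ρp ρm : Expo →₀ ℕ} (h : RankOneCoincidences A ρp ρm) :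
    (∀ e, (Finsupp.single α 1 + Finsupp.single β 1 : Expo →₀ ℕ) e + ρp e =
        (Finsupp.single γ 1 + Finsupp.single δ 1 + Finsupp.single ε 1 : Expo →₀ ℕ) e + ρm e) ∨
      (∀ e, (Finsupp.single γ 1 + Finsupp.single δ 1 + Finsupp.single ε 1 : Expo →₀ ℕ) e + ρp e =
        (Finsupp.single α 1 + Finsupp.single β 1 : Expo →₀ ℕ) e + ρm e) := by
  obtain ⟨k, hk⟩ := shift_of_rankOne_iv hA hα hβ hγ hδ hε hα0 hβ0 hγ0 hδ0 hε0 hrel hij hik hjk h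
  exact shift_rigid (e₀ := α) (by simp [hαβ, hαγ, hαδ, hαε]) k hk

/-- **The only disjoint-support datum is the relation shape itself** (shape `α + β = γ + δ + ε`): values `ρ⁺ = e_γ + e_δ + e_ε`,
`ρ⁻ = e_α + e_β` on the letters and `0` off them — or the swap. [folklore] -/
theorem datum_values_iv (hβγ : β ≠ γ) (hβδ : β ≠ δ) (hβε : β ≠ ε) (hγδ : γ ≠ δ) (hγε : γ ≠ ε) (hδε : δ ≠ ε)
    {ρp ρm : Expo →₀ ℕ} (hdis : ∀ e, ρp e = 0 ∨ ρm e = 0) (h : RankOneCoincidences A ρp ρm) :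
    (ρp α = 0 ∧ ρp β = 0 ∧ ρp γ = 1 ∧ ρp δ = 1 ∧ ρp ε = 1 ∧ ρm α = 1 ∧ ρm β = 1 ∧ ρm γ = 0 ∧ ρm δ = 0 ∧ ρm ε = 0 ∧
        ∀ e, e ≠ α → e ≠ β → e ≠ γ → e ≠ δ → e ≠ ε → ρp e = 0 ∧ ρm e = 0) ∨
      (ρm α = 0 ∧ ρm β = 0 ∧ ρm γ = 1 ∧ ρm δ = 1 ∧ ρm ε = 1 ∧ ρp α = 1 ∧ ρp β = 1 ∧ ρp γ = 0 ∧ ρp δ = 0 ∧ ρp ε = 0 ∧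
        ∀ e, e ≠ α → e ≠ β → e ≠ γ → e ≠ δ → e ≠ ε → ρp e = 0 ∧ ρm e = 0) := by
  have Pα : (Finsupp.single α 1 + Finsupp.single β 1 : Expo →₀ ℕ) α = 1 := by simp [hαβ]
  have Pβ : (Finsupp.single α 1 + Finsupp.single β 1 : Expo →₀ ℕ) β = 1 := by simp [Ne.symm hαβ]
  have Pe : ∀ e, e ≠ α → e ≠ β → (Finsupp.single α 1 + Finsupp.single β 1 : Expo →₀ ℕ) e = 0 :=
    fun e ha hb => by simp [Ne.symm ha, Ne.symm hb]
  have Qγ : (Finsupp.single γ 1 + Finsupp.single δ 1 + Finsupp.single ε 1 : Expo →₀ ℕ) γ = 1 := by simp [hγδ, hγε]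
  have Qδ : (Finsupp.single γ 1 + Finsupp.single δ 1 + Finsupp.single ε 1 : Expo →₀ ℕ) δ = 1 := by simp [Ne.symm hγδ, hδε]
  have Qε : (Finsupp.single γ 1 + Finsupp.single δ 1 + Finsupp.single ε 1 : Expo →₀ ℕ) ε = 1 := by
    simp [Ne.symm hγε, Ne.symm hδε]
  have Qe : ∀ e, e ≠ γ → e ≠ δ → e ≠ ε → (Finsupp.single γ 1 + Finsupp.single δ 1 + Finsupp.single ε 1 : Expo →₀ ℕ) e = 0 :=
    fun e hc hd he => by simp [Ne.symm hc, Ne.symm hd, Ne.symm he]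
  rcases datum_rigid_iv hA hα hβ hγ hδ hε hα0 hβ0 hγ0 hδ0 hε0 hαβ hαγ hαδ hαε hrel hij hik hjk h with H | H
  · left
    have a := values_of_disjoint (H α) (hdis α); have b := values_of_disjoint (H β) (hdis β)
    have c := values_of_disjoint (H γ) (hdis γ); have d := values_of_disjoint (H δ) (hdis δ)
    have x := values_of_disjoint (H ε) (hdis ε)
    rw [Pα, Qe α hαγ hαδ hαε] at a; rw [Pβ, Qe β hβγ hβδ hβε] at b
    rw [Pe γ (Ne.symm hαγ) (Ne.symm hβγ), Qγ] at c; rw [Pe δ (Ne.symm hαδ) (Ne.symm hβδ), Qδ] at d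
    rw [Pe ε (Ne.symm hαε) (Ne.symm hβε), Qε] at x
    refine ⟨a.1, b.1, c.1, d.1, x.1, a.2, b.2, c.2, d.2, x.2, fun e ha hb hc hd he => ?_⟩
    have y := values_of_disjoint (H e) (hdis e)
    rw [Pe e ha hb, Qe e hc hd he] at y
    exact y
  · right
    have a := values_of_disjoint (H α) (hdis α); have b := values_of_disjoint (H β) (hdis β)
    have c := values_of_disjoint (H γ) (hdis γ); have d := values_of_disjoint (H δ) (hdis δ)
    have x := values_of_disjoint (H ε) (hdis ε)
    rw [Pα, Qe α hαγ hαδ hαε] at a; rw [Pβ, Qe β hβγ hβδ hβε] at b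
    rw [Pe γ (Ne.symm hαγ) (Ne.symm hβγ), Qγ] at c; rw [Pe δ (Ne.symm hαδ) (Ne.symm hβδ), Qδ] at d
    rw [Pe ε (Ne.symm hαε) (Ne.symm hβε), Qε] at x
    refine ⟨a.2, b.2, c.2, d.2, x.2, a.1, b.1, c.1, d.1, x.1, fun e ha hb hc hd he => ?_⟩
    have y := values_of_disjoint (H e) (hdis e)
    rw [Pe e ha hb, Qe e hc hd he] at y
    exact ⟨y.1, y.2⟩

end UnitTwoThree

end Summit.ValiantsHypothesis.Theorems.TwoProducts.Negative.RankOneRigidity
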